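import Mathlib.Analysis.Fourier.ZMod
import Mathlib.Analysis.SpecialFunctions.Pow.Real
import Literature.Computability.Cryptography.QubitRegister

/-!
# Crux `DlogGraphFlat` (stmt-QuantumAdvantage-10732), line `Sketch_holder_energy` — stub `stub_heBudgetGlue`

Bookkeeping for the x-side ℓ¹ budget of the Hölder–energy line: if the DFT of the Walsh sign
`a_α(x) = (−1)^{α·bits x}` on `ℤ/N` (`N < 2ⁿ`) is bounded pointwise by a sum over dyadic blocks
`j < n` of Riesz products `Π_{i<j} |1 ± e(2^i θ_k)|`, `θ_k = (−k).val/N` (stub `stub_heRieszBlock`), and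
each such Riesz product sampled at the `N`-th roots of unity has ℓ¹ mass `≤ 256 N (2+√2)^{j/4}` when
`2^j ≤ 4N` (stub `stub_heMeshSampling`), then `Σ_k |𝓕a_α(k)| ≤ 256 (n+1) N (2+√2)^{n/4}`:
swap the two sums, reindex `k ↦ −k`, use `2^j ≤ 2ⁿ ≤ 4N` and `(2+√2)^{j/4} ≤ (2+√2)^{n/4}`.
-/

set_option linter.dupNamespace false -- D-0017: single-problem summit ⇒ `QuantumAdvantage.QuantumAdvantage` by design

namespace Summit.QuantumAdvantage.QuantumAdvantage.Theorems.SymplecticPurity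

open Finset Literature.Computability.Cryptography

/-- **Stub B4 glue of line `Sketch_holder_energy`: the x-side ℓ¹ budget from the block bound and the
sampling bound.** `Σ_k |𝓕a_α(k)| ≤ 256 (n+1) N (2+√2)^{n/4}` for every mask `α`, given the Riesz-block
majorant of `|𝓕a_α(k)|` and the ℓ¹ bound for sampled Riesz products (swap sums, `k ↦ −k`, monotonicity
of `(2+√2)^{·/4}`). [folklore] -/
theorem stub_heBudgetGlue :
    (∀ (n N : ℕ) [NeZero N], N < 2 ^ n → ∀ (α : QReg n) (k : ZMod N),
      ‖ZMod.dft (fun x : ZMod N =>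
          ((∏ i : Fin n, (if α i && x.val.testBit (i : ℕ) then (-1 : ℝ) else 1) : ℝ) : ℂ)) k‖ ≤
        ∑ j ∈ Finset.range n, ∏ i ∈ Finset.range j,
          ‖(1 : ℂ) + (if (if h : i < n then α ⟨i, h⟩ else false) then -1 else 1) *
            Complex.exp (2 * Real.pi * Complex.I *
              (((2 : ℝ) ^ i * (((-k).val : ℝ) / (N : ℝ)) : ℝ) : ℂ))‖) →
    (∀ (m N : ℕ) [NeZero N] (σ : ℕ → Bool), 2 ^ m ≤ 4 * N →
      ∑ k : ZMod N, ∏ i ∈ Finset.range m,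
        ‖(1 : ℂ) + (if σ i then -1 else 1) *
          Complex.exp (2 * Real.pi * Complex.I * (((2 : ℝ) ^ i * ((k.val : ℝ) / (N : ℝ)) : ℝ) : ℂ))‖
      ≤ 256 * (N : ℝ) * (2 + Real.sqrt 2) ^ ((m : ℝ) / 4)) →
    ∀ (n N : ℕ) [NeZero N], N < 2 ^ n → 2 ^ n ≤ 4 * N → ∀ α : QReg n,
      ∑ k : ZMod N, ‖ZMod.dft (fun x : ZMod N =>
          ((∏ i : Fin n, (if α i && x.val.testBit (i : ℕ) then (-1 : ℝ) else 1) : ℝ) : ℂ)) k‖ ≤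
        256 * ((n : ℝ) + 1) * (N : ℝ) * (2 + Real.sqrt 2) ^ ((n : ℝ) / 4) := by
  intro hRB hMESH n N _ hN hN4 α
  -- the sign pattern of the mask, extended by `false`
  set σ : ℕ → Bool := fun i => if h : i < n then α ⟨i, h⟩ else false with hσ
  -- the block majorant, as a function of `j` and of the sample point
  set T : ℕ → ZMod N → ℝ := fun j k => ∏ i ∈ Finset.range j,
      ‖(1 : ℂ) + (if σ i then -1 else 1) *
        Complex.exp (2 * Real.pi * Complex.I * (((2 : ℝ) ^ i * ((k.val : ℝ) / (N : ℝ)) : ℝ) : ℂ))‖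
    with hT
  have hρ : (1 : ℝ) ≤ 2 + Real.sqrt 2 := by
    have := Real.sqrt_nonneg 2
    linarith
  -- step 1: pointwise block bound, summed over `k`
  have h1 : ∑ k : ZMod N, ‖ZMod.dft (fun x : ZMod N =>
        ((∏ i : Fin n, (if α i && x.val.testBit (i : ℕ) then (-1 : ℝ) else 1) : ℝ) : ℂ)) k‖ ≤
      ∑ k : ZMod N, ∑ j ∈ Finset.range n, T j (-k) := by
    refine Finset.sum_le_sum fun k _ => ?_
    have := hRB n N hN α k
    simpa [hT, hσ] using this
  -- step 2: swap the sums and reindex `k ↦ -k`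
  have h2 : ∑ k : ZMod N, ∑ j ∈ Finset.range n, T j (-k) = ∑ j ∈ Finset.range n, ∑ k : ZMod N, T j k := by
    rw [Finset.sum_comm]
    refine Finset.sum_congr rfl fun j _ => ?_
    exact Fintype.sum_equiv (Equiv.neg (ZMod N)) _ _ fun k => rfl
  -- step 3: each block has ℓ¹ mass ≤ 256 N (2+√2)^{j/4} ≤ 256 N (2+√2)^{n/4}
  have h3 : ∀ j ∈ Finset.range n, ∑ k : ZMod N, T j k ≤ 256 * (N : ℝ) * (2 + Real.sqrt 2) ^ ((n : ℝ) / 4) := by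
    intro j hj
    have hjn : j < n := Finset.mem_range.1 hj
    have h2j : 2 ^ j ≤ 4 * N :=
      le_trans (Nat.pow_le_pow_right (by norm_num) hjn.le) hN4
    have hblock := hMESH j N σ h2j
    have hmono : (2 + Real.sqrt 2) ^ ((j : ℝ) / 4) ≤ (2 + Real.sqrt 2) ^ ((n : ℝ) / 4) := by
      refine Real.rpow_le_rpow_of_exponent_le hρ ?_
      have : (j : ℝ) ≤ n := by exact_mod_cast hjn.le
      linarith
    have hN0 : (0 : ℝ) ≤ 256 * (N : ℝ) := by positivity
    calc ∑ k : ZMod N, T j k ≤ 256 * (N : ℝ) * (2 + Real.sqrt 2) ^ ((j : ℝ) / 4) := by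
          simpa [hT] using hblock
      _ ≤ 256 * (N : ℝ) * (2 + Real.sqrt 2) ^ ((n : ℝ) / 4) :=
          mul_le_mul_of_nonneg_left hmono hN0
  -- assembly
  calc ∑ k : ZMod N, ‖ZMod.dft (fun x : ZMod N =>
        ((∏ i : Fin n, (if α i && x.val.testBit (i : ℕ) then (-1 : ℝ) else 1) : ℝ) : ℂ)) k‖
      ≤ ∑ k : ZMod N, ∑ j ∈ Finset.range n, T j (-k) := h1
    _ = ∑ j ∈ Finset.range n, ∑ k : ZMod N, T j k := h2
    _ ≤ ∑ _j ∈ Finset.range n, 256 * (N : ℝ) * (2 + Real.sqrt 2) ^ ((n : ℝ) / 4) := Finset.sum_le_sum h3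
    _ = (n : ℝ) * (256 * (N : ℝ) * (2 + Real.sqrt 2) ^ ((n : ℝ) / 4)) := by
        rw [Finset.sum_const, Finset.card_range, nsmul_eq_mul]
    _ ≤ 256 * ((n : ℝ) + 1) * (N : ℝ) * (2 + Real.sqrt 2) ^ ((n : ℝ) / 4) := by
        have hpos : (0 : ℝ) ≤ 256 * (N : ℝ) * (2 + Real.sqrt 2) ^ ((n : ℝ) / 4) := by positivity
        nlinarith

end Summit.QuantumAdvantage.QuantumAdvantage.Theorems.SymplecticPurity
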